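import Summits.NavierStokesRegularity.NavierStokesRegularity.Theorems.FilamentSkeletonRssCoreLinearInvertibilityOddSymmetrizerBoundsClass
import Summits.NavierStokesRegularity.NavierStokesRegularity.Theorems.FilamentSkeletonRssCoreLinearInvertibilityOddSymmetrizerBoundsNorm

/-!
# Crux `CoreLinearInvertibility` (stmt-NavierStokesRegularity-17973), line `Sketch`:
# stub `stub_oddSymmetrizerBounds` — Maekawa's forward symmetrizer, bounds and the exact identity

Registered stub 6a of the skeleton `Cruxes/CoreLinearInvertibility/Lines/Sketch.lean` (odd sector of
the core linear invertibility estimate).  For `λ ∈ (0,1)` there is `C = C(λ) ≥ 0` such that for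
every odd `C²_c` vorticity `w` with logarithmic potential `ψ = N ∗ w` (`N = (2π)⁻¹ log|·|`) and
symmetrizer `u = Φ(|x|) ψ` (`Φ = kerWeight = G/(2Ω)`): `u ∈ C²` is odd, `w + u` is of second-order
Gaussian class, `T_{λ,R} w = H_{λ,R}(w+u) − L_λ u` for every `R` (`H = L_λ − R v^G·∇` LOCAL), all the
weighted squares are integrable, `L_λ u`, `H(w+u)` are continuous (tools A–C), and

  `‖L_λ u‖²_{X_λ} ≤ C² ‖w‖²_{X_λ}`,  `X_λ = L²(G_λ⁻¹ dx)`.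

Proof of the norm bound (this file): by the Leibniz rule for `L_λ` (`…ClassClosureCalc`) and the
Poisson equation `Δψ = w` (tools A),
`L_λ u = Φ w + Φ b·∇ψ + ψ L_λΦ + 2∇Φ·∇ψ`, `b = ((1+λ)/2 x₀, (1−λ)/2 x₁)`, so with the Gaussian class of
`Φ(|·|)` (tools B) `|L_λ u| ≤ |w| + c (|∇ψ| + |ψ|)`, `c = 6C_Φ(1+|x|)^{N+1}e^{−|x|²/4}`; the weight
`m = G_λ⁻¹c²` is bounded, integrable with its second moment, and tools D bound `∫ m ψ²`, `∫ m|∇ψ|²` by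
`‖w‖²_{X_λ}` (pointwise logarithmic-potential bound, `K ∗ w = (∇ψ)^⊥`, Young's inequality for the
Biot–Savart kernel, `∫ G_λ = 1`).

References: Y. Maekawa, J. Math. Fluid Mech. 13 (2011) §2 (the substitution `u = Φψ`); Th. Gallay,
Y. Maekawa, arXiv:1610.08384, §2.2 Lemma 2.7 and §4.1; Th. Gallay, C. E. Wayne, Comm. Math. Phys. 255
(2005) §4; folklore.
-/

set_option linter.dupNamespace false

noncomputable section

namespace Summit.NavierStokesRegularity.NavierStokesRegularity.Theorems

open MeasureTheory Filter Topology Set Function Metric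
open Literature.Analysis.FluidPDE
open Summit.AnomalousDissipation.AnomalousDissipation.Theorems.MarginalStabilityChainStretchedVortexRows
open scoped InnerProductSpace Laplacian ContDiff

/-! ### The pointwise expansion of `L_λ u` -/

section Expansion

variable {w ψ u : EuclideanSpace ℝ (Fin 2) → ℝ} (hw : ContDiff ℝ 2 w) (hwc : HasCompactSupport w)
  (hψ : ∀ x, ψ x = ∫ y, (2 * Real.pi)⁻¹ * Real.log ‖x - y‖ * w y)
  (hu : ∀ x, u x = kerWeight ‖x‖ * ψ x)

include hw hwc hψ hu in
/-- **`L_λ u = Φ w + Φ b·∇ψ + ψ L_λΦ + 2∇Φ·∇ψ`** (Leibniz rule for `L_λ` and `Δψ = w`). [folklore] -/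
theorem oddSym_L_u_expand (lam : ℝ) (x : EuclideanSpace ℝ (Fin 2)) :
    strainedVorticityOperator lam u x =
      kerWeight ‖x‖ * w x +
      kerWeight ‖x‖ * ((1 + lam) / 2 * x 0 * fderiv ℝ ψ x (EuclideanSpace.single 0 1) +
        (1 - lam) / 2 * x 1 * fderiv ℝ ψ x (EuclideanSpace.single 1 1)) +
      ψ x * strainedVorticityOperator lam (fun y : EuclideanSpace ℝ (Fin 2) => kerWeight ‖y‖) x +
      2 * ∑ i, fderiv ℝ (fun y : EuclideanSpace ℝ (Fin 2) => kerWeight ‖y‖) x (EuclideanSpace.basisFun (Fin 2) ℝ i) *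
          fderiv ℝ ψ x (EuclideanSpace.basisFun (Fin 2) ℝ i) := by
  have hψC2 := (oddSym_psi_contDiff_two hw hwc hψ).1
  have hmul := strainedVorticityOperator_mul (θ := fun y : EuclideanSpace ℝ (Fin 2) => kerWeight ‖y‖) (w := ψ)
    oddSym_theta_contDiff hψC2 lam x
  rw [oddSym_u_eq hu, hmul]
  have hLψ : strainedVorticityOperator lam ψ x = w x +
      ((1 + lam) / 2 * x 0 * fderiv ℝ ψ x (EuclideanSpace.single 0 1) +
        (1 - lam) / 2 * x 1 * fderiv ℝ ψ x (EuclideanSpace.single 1 1)) + ψ x := by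
    rw [strainedVorticityOperator, oddSym_laplacian_psi hw hwc hψ x]; ring
  rw [hLψ]; ring

/-- `|xᵢ ∂ᵢf(x)| ≤ |x| ‖Df(x)‖`. [folklore] -/
theorem oddSym_abs_coord_mul_fderiv_le (f : EuclideanSpace ℝ (Fin 2) → ℝ) (x : EuclideanSpace ℝ (Fin 2)) (i : Fin 2) :
    |x i * fderiv ℝ f x (EuclideanSpace.single i 1)| ≤ ‖x‖ * ‖fderiv ℝ f x‖ := by
  rw [abs_mul]
  refine mul_le_mul (FourierNS.abs_apply_le_norm x i) ?_ (abs_nonneg _) (norm_nonneg _)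
  rw [← Real.norm_eq_abs]
  refine (ContinuousLinearMap.le_opNorm _ _).trans ?_
  have hn : ‖(EuclideanSpace.single i (1 : ℝ) : EuclideanSpace ℝ (Fin 2))‖ = 1 := by simp
  rw [hn, mul_one]

include hw hwc hψ hu in
/-- **`|L_λ u| ≤ |w| + c (‖Dψ‖ + |ψ|)`**, `c = 6 C_Φ (1+|x|)^{N+1} e^{−|x|²/4}`, from the second-order
Gaussian class `(C_Φ, N)` of `Φ(|·|)` and `0 < Φ ≤ 1`, `|λ| ≤ 1`. [folklore] -/
theorem oddSym_abs_L_u_le {Cθ lam : ℝ} {N : ℕ} (hlam : |lam| ≤ 1)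
    (hθ : ∀ x : EuclideanSpace ℝ (Fin 2),
      |kerWeight ‖x‖| ≤ Cθ * (1 + ‖x‖) ^ N * Real.exp (-(‖x‖ ^ 2 / 4)) ∧
      ‖fderiv ℝ (fun y : EuclideanSpace ℝ (Fin 2) => kerWeight ‖y‖) x‖ ≤ Cθ * (1 + ‖x‖) ^ N * Real.exp (-(‖x‖ ^ 2 / 4)) ∧
      ‖fderiv ℝ (fderiv ℝ (fun y : EuclideanSpace ℝ (Fin 2) => kerWeight ‖y‖)) x‖ ≤
        Cθ * (1 + ‖x‖) ^ N * Real.exp (-(‖x‖ ^ 2 / 4)))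
    (x : EuclideanSpace ℝ (Fin 2)) :
    |strainedVorticityOperator lam u x| ≤ |w x| +
      6 * Cθ * (1 + ‖x‖) ^ (N + 1) * Real.exp (-(‖x‖ ^ 2 / 4)) * (‖fderiv ℝ ψ x‖ + |ψ x|) := by
  obtain ⟨h0, h1, h2⟩ := hθ x
  set a : ℝ := Cθ * (1 + ‖x‖) ^ N * Real.exp (-(‖x‖ ^ 2 / 4)) with ha
  have hθpos := kerWeight_pos ‖x‖
  have hθ1 := kerWeight_le_one ‖x‖
  have hθa : kerWeight ‖x‖ ≤ a := (le_abs_self _).trans h0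
  have ha0 : 0 ≤ a := hθpos.le.trans hθa
  have hr := norm_nonneg x
  set D := ‖fderiv ℝ ψ x‖ with hD
  have hD0 : 0 ≤ D := norm_nonneg _
  -- the four pieces
  have e1 : |kerWeight ‖x‖ * w x| ≤ |w x| := by
    rw [abs_mul, abs_of_pos hθpos]; exact mul_le_of_le_one_left (abs_nonneg _) hθ1
  have e2 : |kerWeight ‖x‖ * ((1 + lam) / 2 * x 0 * fderiv ℝ ψ x (EuclideanSpace.single 0 1) +
      (1 - lam) / 2 * x 1 * fderiv ℝ ψ x (EuclideanSpace.single 1 1))| ≤ a * (2 * ‖x‖ * D) := by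
    rw [abs_mul, abs_of_pos hθpos]
    refine mul_le_mul hθa ?_ (abs_nonneg _) ha0
    have hl1 : |(1 + lam) / 2| ≤ 1 := by
      rw [abs_le] at hlam ⊢; constructor <;> linarith [hlam.1, hlam.2]
    have hl2 : |(1 - lam) / 2| ≤ 1 := by
      rw [abs_le] at hlam ⊢; constructor <;> linarith [hlam.1, hlam.2]
    have k0 := oddSym_abs_coord_mul_fderiv_le ψ x 0
    have k1 := oddSym_abs_coord_mul_fderiv_le ψ x 1
    have f0 : |(1 + lam) / 2 * x 0 * fderiv ℝ ψ x (EuclideanSpace.single 0 1)| ≤ ‖x‖ * D := by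
      rw [mul_assoc, abs_mul]
      exact (mul_le_mul hl1 k0 (abs_nonneg _) zero_le_one).trans (by rw [one_mul])
    have f1 : |(1 - lam) / 2 * x 1 * fderiv ℝ ψ x (EuclideanSpace.single 1 1)| ≤ ‖x‖ * D := by
      rw [mul_assoc, abs_mul]
      exact (mul_le_mul hl2 k1 (abs_nonneg _) zero_le_one).trans (by rw [one_mul])
    exact (abs_add_le _ _).trans (by linarith)
  have e3 : |ψ x * strainedVorticityOperator lam (fun y : EuclideanSpace ℝ (Fin 2) => kerWeight ‖y‖) x| ≤
      |ψ x| * (3 * (1 + ‖x‖) * a) := by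
    rw [abs_mul]
    exact mul_le_mul_of_nonneg_left (oddSym_abs_strainedVorticityOperator_le hlam h0 h1 h2) (abs_nonneg _)
  have e4 : |2 * ∑ i, fderiv ℝ (fun y : EuclideanSpace ℝ (Fin 2) => kerWeight ‖y‖) x (EuclideanSpace.basisFun (Fin 2) ℝ i) *
      fderiv ℝ ψ x (EuclideanSpace.basisFun (Fin 2) ℝ i)| ≤ 4 * (a * D) := by
    have hk : ∀ i : Fin 2, |fderiv ℝ (fun y : EuclideanSpace ℝ (Fin 2) => kerWeight ‖y‖) x (EuclideanSpace.basisFun (Fin 2) ℝ i) *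
        fderiv ℝ ψ x (EuclideanSpace.basisFun (Fin 2) ℝ i)| ≤ a * D := by
      intro i
      have hn : ‖(EuclideanSpace.basisFun (Fin 2) ℝ i : EuclideanSpace ℝ (Fin 2))‖ = 1 := by simp
      rw [abs_mul]
      refine mul_le_mul ?_ ?_ (abs_nonneg _) ha0
      · rw [← Real.norm_eq_abs]
        exact (ContinuousLinearMap.le_opNorm _ _).trans (by rw [hn, mul_one]; exact h1)
      · rw [← Real.norm_eq_abs]
        exact (ContinuousLinearMap.le_opNorm _ _).trans (by rw [hn, mul_one])
    rw [abs_mul, abs_two, Fin.sum_univ_two]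
    have := hk 0; have := hk 1
    linarith [abs_add_le (fderiv ℝ (fun y : EuclideanSpace ℝ (Fin 2) => kerWeight ‖y‖) x (EuclideanSpace.basisFun (Fin 2) ℝ 0) *
        fderiv ℝ ψ x (EuclideanSpace.basisFun (Fin 2) ℝ 0))
      (fderiv ℝ (fun y : EuclideanSpace ℝ (Fin 2) => kerWeight ‖y‖) x (EuclideanSpace.basisFun (Fin 2) ℝ 1) *
        fderiv ℝ ψ x (EuclideanSpace.basisFun (Fin 2) ℝ 1))]
  rw [oddSym_L_u_expand hw hwc hψ hu lam x]
  have key : 6 * Cθ * (1 + ‖x‖) ^ (N + 1) * Real.exp (-(‖x‖ ^ 2 / 4)) = 6 * (1 + ‖x‖) * a := by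
    rw [pow_succ]; ring
  rw [key]
  have hψ0 := abs_nonneg (ψ x)
  calc _ ≤ |kerWeight ‖x‖ * w x| + |kerWeight ‖x‖ * ((1 + lam) / 2 * x 0 * fderiv ℝ ψ x (EuclideanSpace.single 0 1) +
          (1 - lam) / 2 * x 1 * fderiv ℝ ψ x (EuclideanSpace.single 1 1))| +
        |ψ x * strainedVorticityOperator lam (fun y : EuclideanSpace ℝ (Fin 2) => kerWeight ‖y‖) x| +
        |2 * ∑ i, fderiv ℝ (fun y : EuclideanSpace ℝ (Fin 2) => kerWeight ‖y‖) x (EuclideanSpace.basisFun (Fin 2) ℝ i) *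
          fderiv ℝ ψ x (EuclideanSpace.basisFun (Fin 2) ℝ i)| :=
        (abs_add_le _ _).trans (add_le_add ((abs_add_le _ _).trans (add_le_add (abs_add_le _ _) le_rfl)) le_rfl)
    _ ≤ |w x| + a * (2 * ‖x‖ * D) + |ψ x| * (3 * (1 + ‖x‖) * a) + 4 * (a * D) := by linarith
    _ ≤ |w x| + 6 * (1 + ‖x‖) * a * (D + |ψ x|) := by
        nlinarith [mul_nonneg ha0 hD0, mul_nonneg (mul_nonneg ha0 hD0) hr, mul_nonneg ha0 hψ0,
          mul_nonneg (mul_nonneg ha0 hψ0) hr]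

/-- Squares: `|L| ≤ |w| + c(D + |ψ|)` with `c ≥ 0` gives `L² ≤ 3(w² + c²D² + c²ψ²)`. [folklore] -/
theorem oddSym_sq_le_of_abs_le {L w c D p : ℝ} (hc : 0 ≤ c) (hD : 0 ≤ D) (h : |L| ≤ |w| + c * (D + |p|)) :
    L ^ 2 ≤ 3 * (w ^ 2 + c ^ 2 * D ^ 2 + c ^ 2 * p ^ 2) := by
  have h0 : 0 ≤ |w| + c * (D + |p|) := by positivity
  have h1 : L ^ 2 ≤ (|w| + c * (D + |p|)) ^ 2 := by
    rw [← sq_abs L]; exact pow_le_pow_left₀ (abs_nonneg _) h 2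
  have h2 : (|w| + c * (D + |p|)) ^ 2 ≤ 3 * (|w| ^ 2 + (c * D) ^ 2 + (c * |p|) ^ 2) := by
    nlinarith [sq_nonneg (|w| - c * D), sq_nonneg (|w| - c * |p|), sq_nonneg (c * D - c * |p|)]
  rw [sq_abs, mul_pow, mul_pow, sq_abs] at h2
  linarith

end Expansion

/-! ### The weight `m = G_λ⁻¹ c²` -/

/-- `G_λ⁻¹ X² ≤ (4πC)² (1−λ)⁻¹ (1+|x|)^{2N} G` for `|X| ≤ C(1+|x|)^N e^{−|x|²/4}`, `λ ∈ [0,1)`. [folklore] -/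
theorem oddSym_inv_gaussWeightLam_mul_sq_le {lam : ℝ} (hlam : lam ∈ Set.Ico (0 : ℝ) 1) {X C : ℝ} {N : ℕ}
    (x : EuclideanSpace ℝ (Fin 2)) (hX : |X| ≤ C * (1 + ‖x‖) ^ N * Real.exp (-(‖x‖ ^ 2 / 4))) :
    (gaussWeightLam lam x)⁻¹ * X ^ 2 ≤ (C * (4 * Real.pi)) ^ 2 * (1 - lam)⁻¹ * ((1 + ‖x‖) ^ (2 * N) * gaussVortexProfile x) := by
  have hg0 : 0 ≤ (gaussWeightLam lam x)⁻¹ := (inv_pos.2 (gaussWeightLam_pos hlam.2 x)).le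
  have hGG := inv_gaussWeightLam_mul_gaussVortexProfile_le hlam x
  have hexp : Real.exp (-(‖x‖ ^ 2 / 4)) = 4 * Real.pi * gaussVortexProfile x := by
    rw [gaussVortexProfile]; field_simp
  have h1 : |X| ≤ C * (4 * Real.pi) * (1 + ‖x‖) ^ N * gaussVortexProfile x := by rw [hexp] at hX; linarith
  have h2 : X ^ 2 ≤ (C * (4 * Real.pi) * (1 + ‖x‖) ^ N * gaussVortexProfile x) ^ 2 := by
    rw [← sq_abs]; exact pow_le_pow_left₀ (abs_nonneg _) h1 2
  have h3 : 0 ≤ (1 + ‖x‖) ^ (2 * N) * gaussVortexProfile x := by have := gaussVortexProfile_pos x; positivity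
  calc (gaussWeightLam lam x)⁻¹ * X ^ 2
      ≤ (gaussWeightLam lam x)⁻¹ * (C * (4 * Real.pi) * (1 + ‖x‖) ^ N * gaussVortexProfile x) ^ 2 :=
        mul_le_mul_of_nonneg_left h2 hg0
    _ = (C * (4 * Real.pi)) ^ 2 * (((gaussWeightLam lam x)⁻¹ * gaussVortexProfile x) *
          ((1 + ‖x‖) ^ (2 * N) * gaussVortexProfile x)) := by rw [pow_mul']; ring
    _ ≤ (C * (4 * Real.pi)) ^ 2 * ((1 - lam)⁻¹ * ((1 + ‖x‖) ^ (2 * N) * gaussVortexProfile x)) :=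
        mul_le_mul_of_nonneg_left (mul_le_mul_of_nonneg_right hGG h3) (sq_nonneg _)
    _ = _ := by ring

/-- **The weight `m = G_λ⁻¹ c²`, `c = 6C_Φ(1+|x|)^{N+1}e^{−|x|²/4}`, is nonnegative, bounded,
measurable, integrable, and has an integrable second moment** (`λ ∈ [0,1)`). [folklore] -/
theorem oddSym_weight_props {lam Cθ : ℝ} (hlam : lam ∈ Set.Ico (0 : ℝ) 1) (hCθ : 0 ≤ Cθ) (N : ℕ)
    {m : EuclideanSpace ℝ (Fin 2) → ℝ}
    (hm : ∀ x, m x = (gaussWeightLam lam x)⁻¹ * (6 * Cθ * (1 + ‖x‖) ^ (N + 1) * Real.exp (-(‖x‖ ^ 2 / 4))) ^ 2) :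
    (∀ x, 0 ≤ m x) ∧
    (∀ x, m x ≤ (6 * Cθ * (4 * Real.pi)) ^ 2 * (1 - lam)⁻¹ *
      ((4 * Real.pi)⁻¹ * (2 ^ (2 * (N + 1)) * (2 + 8 ^ (2 * (N + 1)) * (2 * (N + 1)).factorial)))) ∧
    AEStronglyMeasurable m volume ∧ Integrable m ∧ Integrable (fun x => m x * (1 + ‖x‖) ^ 2) := by
  have hmf : m = fun x => (gaussWeightLam lam x)⁻¹ * (6 * Cθ * (1 + ‖x‖) ^ (N + 1) * Real.exp (-(‖x‖ ^ 2 / 4))) ^ 2 :=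
    funext hm
  have hl1 := hlam.2
  have hc : Continuous fun x : EuclideanSpace ℝ (Fin 2) => 6 * Cθ * (1 + ‖x‖) ^ (N + 1) * Real.exp (-(‖x‖ ^ 2 / 4)) :=
    ((continuous_const.mul ((continuous_const.add continuous_norm).pow _)).mul
      (Real.continuous_exp.comp ((continuous_norm.pow 2).div_const _).neg))
  have hmc : Continuous m := by rw [hmf]; exact (continuous_inv_gaussWeightLam hl1).mul (hc.pow 2)
  have habs : ∀ x : EuclideanSpace ℝ (Fin 2), |6 * Cθ * (1 + ‖x‖) ^ (N + 1) * Real.exp (-(‖x‖ ^ 2 / 4))| ≤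
      6 * Cθ * (1 + ‖x‖) ^ (N + 1) * Real.exp (-(‖x‖ ^ 2 / 4)) := fun x => (abs_of_nonneg (by positivity)).le
  have habs2 : ∀ x : EuclideanSpace ℝ (Fin 2), |6 * Cθ * (1 + ‖x‖) ^ (N + 1) * Real.exp (-(‖x‖ ^ 2 / 4)) * (1 + ‖x‖)| ≤
      6 * Cθ * (1 + ‖x‖) ^ (N + 2) * Real.exp (-(‖x‖ ^ 2 / 4)) := fun x => by
    rw [abs_of_nonneg (by positivity), pow_succ _ (N + 1)]; linarith
  refine ⟨fun x => ?_, fun x => ?_, hmc.aestronglyMeasurable, ?_, ?_⟩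
  · rw [hm]; exact mul_nonneg (inv_pos.2 (gaussWeightLam_pos hl1 x)).le (sq_nonneg _)
  · rw [hm]
    refine (oddSym_inv_gaussWeightLam_mul_sq_le hlam x (habs x)).trans ?_
    have hq : 0 < 1 - lam := by linarith
    exact mul_le_mul_of_nonneg_left (one_add_norm_pow_mul_gaussVortexProfile_le (2 * (N + 1)) x) (by positivity)
  · rw [hmf]; exact oddSym_integrable_inv_gaussWeightLam_mul_sq hlam hc.aestronglyMeasurable habs
  · have := oddSym_integrable_inv_gaussWeightLam_mul_sq hlam
      (X := fun x => 6 * Cθ * (1 + ‖x‖) ^ (N + 1) * Real.exp (-(‖x‖ ^ 2 / 4)) * (1 + ‖x‖))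
      (hc.mul (continuous_const.add continuous_norm)).aestronglyMeasurable habs2
    refine this.congr (Eventually.of_forall fun x => ?_)
    dsimp only
    rw [hm]; ring

/-! ### The registered stub -/

/-- **Stub 6a of crux stmt-NavierStokesRegularity-17973, line `Sketch` (forward symmetrizer: bounds
and the exact identity).** For `λ ∈ (0,1)` there is `C ≥ 0` such that for every odd `C²_c`
vorticity `w`, with `ψ = N∗w` and `u = Φ(|x|)ψ` (`Φ = kerWeight`): `u ∈ C²` is odd, `w + u` is of
Gaussian class (with gradient and Hessian), `T_{λ,R} w = H_{λ,R}(w+u) − L_λ u` pointwise for every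
`R`, all the weighted squares met are integrable, `L_λ u` and `H(w+u)` are continuous, and
`‖L_λ u‖_{X_λ} ≤ C ‖w‖_{X_λ}`. [folklore] -/
theorem stub_oddSymmetrizerBounds :
    ∀ lam ∈ Set.Ioo (0 : ℝ) 1, ∃ C : ℝ, 0 ≤ C ∧
    ∀ (w ψ u : EuclideanSpace ℝ (Fin 2) → ℝ), ContDiff ℝ 2 w → HasCompactSupport w →
    (∀ x, w (-x) = -w x) →
    (∀ x, ψ x = ∫ y, (2 * Real.pi)⁻¹ * Real.log ‖x - y‖ * w y) →
    (∀ x, u x = kerWeight ‖x‖ * ψ x) →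
    ContDiff ℝ 2 u ∧ (∀ x, u (-x) = -u x) ∧
    (∃ (C' : ℝ) (N : ℕ), ∀ x : EuclideanSpace ℝ (Fin 2),
      |w x + u x| ≤ C' * (1 + ‖x‖) ^ N * Real.exp (-(‖x‖ ^ 2 / 4)) ∧
      ‖fderiv ℝ (fun y => w y + u y) x‖ ≤ C' * (1 + ‖x‖) ^ N * Real.exp (-(‖x‖ ^ 2 / 4)) ∧
      ‖fderiv ℝ (fderiv ℝ (fun y => w y + u y)) x‖ ≤ C' * (1 + ‖x‖) ^ N * Real.exp (-(‖x‖ ^ 2 / 4))) ∧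
    (∀ (R : ℝ) (x : EuclideanSpace ℝ (Fin 2)),
      strainedVorticityOperator lam w x -
          R * (⟪gaussVortexVelocity x, gradient w x⟫_ℝ +
            ⟪biotSavart2D w x, gradient gaussVortexProfile x⟫_ℝ) =
        (strainedVorticityOperator lam (fun y => w y + u y) x -
            R * ⟪gaussVortexVelocity x, gradient (fun y => w y + u y) x⟫_ℝ) -
          strainedVorticityOperator lam u x) ∧
    Integrable (fun x => (gaussWeightLam lam x)⁻¹ * w x ^ 2) ∧
    (∀ R : ℝ, Integrable (fun x => (gaussWeightLam lam x)⁻¹ * (strainedVorticityOperator lam w x -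
      R * (⟪gaussVortexVelocity x, gradient w x⟫_ℝ +
        ⟪biotSavart2D w x, gradient gaussVortexProfile x⟫_ℝ)) ^ 2)) ∧
    Integrable (fun x => (gaussWeightLam lam x)⁻¹ * (w x + u x) ^ 2) ∧
    Integrable (fun x => (gaussWeightLam lam x)⁻¹ * (strainedVorticityOperator lam u x) ^ 2) ∧
    (∀ R : ℝ, Integrable (fun x => (gaussWeightLam lam x)⁻¹ *
      (strainedVorticityOperator lam (fun y => w y + u y) x -
        R * ⟪gaussVortexVelocity x, gradient (fun y => w y + u y) x⟫_ℝ) ^ 2)) ∧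
    Continuous (fun x => strainedVorticityOperator lam u x) ∧
    (∀ R : ℝ, Continuous (fun x => strainedVorticityOperator lam (fun y => w y + u y) x -
        R * ⟪gaussVortexVelocity x, gradient (fun y => w y + u y) x⟫_ℝ)) ∧
    ∫ x, (gaussWeightLam lam x)⁻¹ * (strainedVorticityOperator lam u x) ^ 2 ≤
      C ^ 2 * ∫ x, (gaussWeightLam lam x)⁻¹ * w x ^ 2 := by
  intro lam hlam
  have hlam' : lam ∈ Set.Ico (0 : ℝ) 1 := ⟨hlam.1.le, hlam.2⟩
  have hl1 : lam < 1 := hlam.2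
  have hl : |lam| ≤ 1 := by rw [abs_le]; constructor <;> linarith [hlam.1, hlam.2]
  obtain ⟨Cθ, N, hCθ, hθ⟩ := oddSym_theta_bounds
  obtain ⟨CY, hCY, hY⟩ := biotSavart2D_mul_sq_integral_le
  -- the weight `m = G_λ⁻¹ c²` and the constants
  set m : EuclideanSpace ℝ (Fin 2) → ℝ := fun x => (gaussWeightLam lam x)⁻¹ *
    (6 * Cθ * (1 + ‖x‖) ^ (N + 1) * Real.exp (-(‖x‖ ^ 2 / 4))) ^ 2 with hm_def
  obtain ⟨hm0, hmH, hmm, hmi, hmi2⟩ := oddSym_weight_props hlam' hCθ N (m := m) (fun x => rfl)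
  set Hm : ℝ := (6 * Cθ * (4 * Real.pi)) ^ 2 * (1 - lam)⁻¹ *
    ((4 * Real.pi)⁻¹ * (2 ^ (2 * (N + 1)) * (2 + 8 ^ (2 * (N + 1)) * (2 * (N + 1)).factorial))) with hHm_def
  set sl : ℝ := (1 - lam) / (4 * Real.pi) with hsl_def
  set I₀ : ℝ := ∫ z, (ball (0 : EuclideanSpace ℝ (Fin 2)) 1).indicator (fun z => -Real.log ‖z‖) z with hI₀_def
  set M₂ : ℝ := ∫ x : EuclideanSpace ℝ (Fin 2), ‖x‖ ^ 2 * gaussWeightLam lam x with hM₂_def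
  set Im : ℝ := ∫ x, m x with hIm_def
  set Im2 : ℝ := ∫ x, m x * (1 + ‖x‖) ^ 2 with hIm2_def
  have hq : 0 < 1 - lam := by linarith
  have hHm0 : 0 ≤ Hm := by positivity
  have hsl0 : 0 ≤ sl := by positivity
  have hIm0 : 0 ≤ Im := integral_nonneg hm0
  have hIm20 : 0 ≤ Im2 := integral_nonneg fun x => mul_nonneg (hm0 x) (sq_nonneg _)
  have hM₂0 : 0 ≤ M₂ := integral_nonneg fun x => mul_nonneg (sq_nonneg _) (gaussWeightLam_pos hl1 x).le
  set K : ℝ := 3 * (1 + CY * (Hm * sl + Im) + 3 * (2 * Real.pi)⁻¹ ^ 2 * (I₀ ^ 2 * Hm * sl + Im2 + M₂ * Im)) with hK_def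
  have hK0 : 0 ≤ K := by positivity
  refine ⟨Real.sqrt K, Real.sqrt_nonneg K, ?_⟩
  intro w ψ u hw hwc hodd hψ hu
  obtain ⟨huC2, huodd, hclass, hident, hrest⟩ := stub_oddSymmetrizerBoundsToolsC w ψ u hw hwc hψ hu
  obtain ⟨hIw, hIwu, hILu, hIH, hcL, hcH⟩ := hrest lam hlam
  obtain ⟨C', N', -, hclass'⟩ := hclass
  refine ⟨huC2, huodd hodd, ⟨C', N', hclass'⟩, hident lam, hIw,
    fun R => parity_integrable_weight_mul_coreOp_sq hlam' R hw hwc, hIwu, hILu, hIH, hcL, hcH, ?_⟩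
  -- the norm bound
  set S : ℝ := ∫ x, (gaussWeightLam lam x)⁻¹ * w x ^ 2 with hS_def
  have hψC2 := (oddSym_psi_contDiff_two hw hwc hψ).1
  obtain ⟨hIψ, hψle⟩ := oddSym_integral_weight_mul_psi_sq_le hmm hm0 hmH hmi hmi2 hw.continuous hwc
    hψC2.continuous hψ
  obtain ⟨hIDψ, hDψle⟩ := oddSym_integral_weight_mul_norm_fderiv_psi_sq_le hmm hm0 hmH hmi hY hw hwc hψ
  have hn1 := oddSym_sq_integral_abs_le hl1 hw.continuous hIw
  have hm1 := oddSym_sq_integral_norm_mul_abs_le hl1 hw.continuous hIw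
  have hwc2 : HasCompactSupport (fun y => w y ^ 2) := hwc.mono fun y hy => by simpa using hy
  have hw2i : Integrable fun y => w y ^ 2 := (hw.continuous.pow 2).integrable_of_hasCompactSupport hwc2
  have hw2 := oddSym_integral_sq_le hl1 hw2i hIw
  have hS0 : 0 ≤ S := integral_nonneg fun x => mul_nonneg (inv_pos.2 (gaussWeightLam_pos hl1 x)).le (sq_nonneg _)
  have hW20 : 0 ≤ ∫ y, w y ^ 2 := integral_nonneg fun y => sq_nonneg _
  -- pointwise majorant `G_λ⁻¹ (L_λ u)² ≤ 3 (G_λ⁻¹ w² + m |Dψ|² + m ψ²)`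
  have hpt : ∀ x, (gaussWeightLam lam x)⁻¹ * (strainedVorticityOperator lam u x) ^ 2 ≤
      3 * ((gaussWeightLam lam x)⁻¹ * w x ^ 2 + m x * ‖fderiv ℝ ψ x‖ ^ 2 + m x * ψ x ^ 2) := fun x => by
    have hg0 : 0 ≤ (gaussWeightLam lam x)⁻¹ := (inv_pos.2 (gaussWeightLam_pos hl1 x)).le
    have hc0 : 0 ≤ 6 * Cθ * (1 + ‖x‖) ^ (N + 1) * Real.exp (-(‖x‖ ^ 2 / 4)) := by positivity
    have h := oddSym_sq_le_of_abs_le hc0 (norm_nonneg (fderiv ℝ ψ x)) (oddSym_abs_L_u_le hw hwc hψ hu hl hθ x)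
    calc (gaussWeightLam lam x)⁻¹ * (strainedVorticityOperator lam u x) ^ 2
        ≤ (gaussWeightLam lam x)⁻¹ * (3 * (w x ^ 2 +
            (6 * Cθ * (1 + ‖x‖) ^ (N + 1) * Real.exp (-(‖x‖ ^ 2 / 4))) ^ 2 * ‖fderiv ℝ ψ x‖ ^ 2 +
            (6 * Cθ * (1 + ‖x‖) ^ (N + 1) * Real.exp (-(‖x‖ ^ 2 / 4))) ^ 2 * ψ x ^ 2)) :=
          mul_le_mul_of_nonneg_left h hg0
      _ = _ := by simp only [hm_def]; ring
  have hF1 : Integrable fun x => (gaussWeightLam lam x)⁻¹ * w x ^ 2 + m x * ‖fderiv ℝ ψ x‖ ^ 2 := hIw.add hIDψ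
  have hF12 : Integrable fun x => (gaussWeightLam lam x)⁻¹ * w x ^ 2 + m x * ‖fderiv ℝ ψ x‖ ^ 2 + m x * ψ x ^ 2 :=
    hF1.add hIψ
  have hF : Integrable fun x => 3 * ((gaussWeightLam lam x)⁻¹ * w x ^ 2 + m x * ‖fderiv ℝ ψ x‖ ^ 2 + m x * ψ x ^ 2) :=
    hF12.const_mul 3
  have hc' : (0:ℝ) ≤ 3 * (2 * Real.pi)⁻¹ ^ 2 := by positivity
  calc ∫ x, (gaussWeightLam lam x)⁻¹ * (strainedVorticityOperator lam u x) ^ 2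
      ≤ ∫ x, 3 * ((gaussWeightLam lam x)⁻¹ * w x ^ 2 + m x * ‖fderiv ℝ ψ x‖ ^ 2 + m x * ψ x ^ 2) :=
        integral_mono hILu hF hpt
    _ = 3 * (S + (∫ x, m x * ‖fderiv ℝ ψ x‖ ^ 2) + ∫ x, m x * ψ x ^ 2) := by
        rw [integral_const_mul, integral_add hF1 hIψ, integral_add hIw hIDψ]
    _ ≤ 3 * (S + CY * (Hm * (∫ y, w y ^ 2) + (∫ y, |w y|) ^ 2 * Im) +
        3 * (2 * Real.pi)⁻¹ ^ 2 * (I₀ ^ 2 * Hm * (∫ y, w y ^ 2) + (∫ y, |w y|) ^ 2 * Im2 + (∫ y, ‖y‖ * |w y|) ^ 2 * Im)) := by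
        linarith [hDψle, hψle]
    _ ≤ 3 * (S + CY * (Hm * (sl * S) + S * Im) +
        3 * (2 * Real.pi)⁻¹ ^ 2 * (I₀ ^ 2 * Hm * (sl * S) + S * Im2 + (M₂ * S) * Im)) := by
        have a1 : Hm * (∫ y, w y ^ 2) ≤ Hm * (sl * S) := mul_le_mul_of_nonneg_left hw2 hHm0
        have a2 : (∫ y, |w y|) ^ 2 * Im ≤ S * Im := mul_le_mul_of_nonneg_right hn1 hIm0
        have a3 : I₀ ^ 2 * Hm * (∫ y, w y ^ 2) ≤ I₀ ^ 2 * Hm * (sl * S) :=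
          mul_le_mul_of_nonneg_left hw2 (mul_nonneg (sq_nonneg _) hHm0)
        have a4 : (∫ y, |w y|) ^ 2 * Im2 ≤ S * Im2 := mul_le_mul_of_nonneg_right hn1 hIm20
        have a5 : (∫ y, ‖y‖ * |w y|) ^ 2 * Im ≤ (M₂ * S) * Im := mul_le_mul_of_nonneg_right hm1 hIm0
        have b1 : CY * (Hm * (∫ y, w y ^ 2) + (∫ y, |w y|) ^ 2 * Im) ≤ CY * (Hm * (sl * S) + S * Im) :=
          mul_le_mul_of_nonneg_left (add_le_add a1 a2) hCY.le
        have b2 : 3 * (2 * Real.pi)⁻¹ ^ 2 * (I₀ ^ 2 * Hm * (∫ y, w y ^ 2) + (∫ y, |w y|) ^ 2 * Im2 + (∫ y, ‖y‖ * |w y|) ^ 2 * Im) ≤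
            3 * (2 * Real.pi)⁻¹ ^ 2 * (I₀ ^ 2 * Hm * (sl * S) + S * Im2 + (M₂ * S) * Im) :=
          mul_le_mul_of_nonneg_left (add_le_add (add_le_add a3 a4) a5) hc'
        linarith
    _ = K * S := by simp only [hK_def]; ring
    _ = Real.sqrt K ^ 2 * S := by rw [Real.sq_sqrt hK0]

end Summit.NavierStokesRegularity.NavierStokesRegularity.Theorems
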